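import Summits.CriticalPhenomena.PercolationContinuityZ3.Theorems.Transplant.SkelFrmQuasiBParamsFaceFloorsClrXA
import Summits.CriticalPhenomena.PercolationContinuityZ3.Theorems.Transplant.SkelFrmBParamsFaceFloorsClrXA
import Summits.CriticalPhenomena.PercolationContinuityZ3.Theorems.Transplant.SkelFrmQuasiBParamsBridgeFrameF
import Summits.CriticalPhenomena.PercolationContinuityZ3.Theorems.Transplant.SkelFrmBParamsBridgeFrameF
import Summits.CriticalPhenomena.PercolationContinuityZ3.Theorems.Transplant.SkelFrmQuasiBParamsFaceFloorsTYA
import Summits.CriticalPhenomena.PercolationContinuityZ3.Theorems.Transplant.SkelFrmBParamsFaceFloorsTYA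
import Summits.CriticalPhenomena.PercolationContinuityZ3.Theorems.Transplant.SkelNegBParamsFaceFloorsPiXA
import Summits.CriticalPhenomena.PercolationContinuityZ3.Theorems.Transplant.PlanarSkeletonFrmQuasiDefs
import Summits.CriticalPhenomena.PercolationContinuityZ3.Theorems.Transplant.PlanarSkeletonFrmDefs
import Summits.CriticalPhenomena.PercolationContinuityZ3.Theorems.Transplant.SkelPhiStepIDataNS
import HarnessLib
import Summits.CriticalPhenomena.PercolationContinuityZ3.Theorems.Transplant.SkelFrmBParamsFaceFloorsPiXA
/-!
# GEN-Q PORT (WAVE-Q table v0.8 section 2, row G187, U-level L19; captain R-6/R-7 2026-08-27: carrier token swap `PlanarSkeletonFrmFrom ↦ PlanarSkeletonFrmQuasi`)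
# of the tree module «Transplant/SkelFrmFromBParamsFaceFloorsPiXA» (sha256 82665465dbf37df5…) onto the quasi-step carrier `PlanarSkeletonFrmQuasi` (p507026): «SkelFrmQuasiBParamsFaceFloorsPiXA»

ORIGINAL TITLE: (F) VALUE LAYER, N2 twin (hp-8 g42, 2026-08-23; F-DISCHARGE-MAP-N2 G18 x-face REACH floors `hπ2X`/`hπ3X`): `port_frm.py` text of N1 `SkelNegBParamsFaceFloorsPiXA`

builds on p205010 (kernel theorem, internal audit signed; external expert review pending) — nothing in this file uses p205010; NOTHING is claimed about any open node
((N3-b), the end state).  Lane `prim-bschramm`, seat `prim-bschramm-stmt` (gen 33; GEN-Q column pen; tool = captain gen-1 g4's port_genq.py R-14 --cone + p3-g30's T1 patch).  Helper file (`--supports stmt-CriticalPhenomena-4575 --as helper`).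
PORT RULES (U-wave r1–r4 re-used, GEN-Q hunk classes of p3-g29 #6136): declaration order, names and proof texts are those of «SkelFrmFromBParamsFaceFloorsPiXA», byte-identical except
(i) the carrier token `PlanarSkeletonFrmFrom ↦ PlanarSkeletonFrmQuasi` in binders, `namespace`/`end` lines and qualified names (module names `SkelFrmFrom… ↦ SkelFrmQuasi…`
in imports of already-ported rows); (ii) `Φ.step ↦ Φ.qstep` with the called Steps lemma replaced by its `…Q`/`_q` twin and the cost `Φ.M` threaded (none in this file unless
listed below); (iii) `Φ.cyl_connected ↦ Φ.cyl_reach` readers (none unless listed); (iv) graph-ball radii / window floors ×`Φ.M` (none unless listed).  Carrier-free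
residents stay imported/exported from the original «SkelFrmBParamsFaceFloorsPiXA» exactly as in the FrmFrom port.  Docstrings and citations are the original's.

-/

noncomputable section

open scoped Classical

namespace Summit.CriticalPhenomena.PercolationContinuityZ3.Theorems.Transplant

namespace PlanarSkeletonFrmQuasi

namespace NegB

open Literature.Probability.Percolation Literature.Probability.LatticeModels SimpleGraph
open Literature.Probability.Percolation.KozmaNitzan.Cells (oth sgOf sgOf_sign)
open SkelConc (Consts)
open Skelφ (shearUnit shearUnit_pos crossOffX yPrmW)
open Skelφ.StepI (DataN)
open TwoAxis.Para (modulus)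
open Neg

namespace KS

/-! ## §1 Generic arithmetic (chain-free) -/

section Arith

export PlanarSkeletonNeg.NegB.KS (clr_kterm_le)

end Arith

/-! ## §2 Sizes at the (ζ′) tuple -/

section Sizes

/-- **The tangential origin's size**: `|yT 0| + |yT 1| ≤ |yL 0| + |yL 1| + (Nr+1)·U + 11·n_L + 1` for `yT = yL + crossOffX n_L h_L v_L σ σT Nr`
(`σ, σT = ±1`, `|v_L| ≤ n_L`, `|h_L| ≤ 10·n_L`). [folklore] -/
theorem clr_crossOffX_l1 (κ : Consts) {V : Type} [DecidableEq V] [Countable V] {G : SimpleGraph V} [G.LocallyFinite] (Φ : PlanarSkeletonFrmQuasi G) (t : V) (p : unitInterval) (D : Skelφ.StepI.DataNS V) (g : ℕ) (f : ℕ) (hN : EqNumL κ Φ t p D g f) (hκ : (hL κ Φ t p D g f).natAbs ≤ 10 * nL κ Φ t p D g f) (yL : Site 2)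
    {σ σT : ℤ} (hσ : σ = 1 ∨ σ = -1) (hσT : σT = 1 ∨ σT = -1) (Nr : ℕ) :
    ((yL + crossOffX (nL κ Φ t p D g f) (hL κ Φ t p D g f) (vL κ Φ t p D g f) σ σT Nr) 0).natAbs +
        ((yL + crossOffX (nL κ Φ t p D g f) (hL κ Φ t p D g f) (vL κ Φ t p D g f) σ σT Nr) 1).natAbs ≤
      (yL 0).natAbs + (yL 1).natAbs + (Nr + 1) * shearUnit (nL κ Φ t p D g f) (hL κ Φ t p D g f) + 11 * nL κ Φ t p D g f + 1 := by
  obtain ⟨hn1, -⟩ := one_le_of_eqNumL κ Φ t p D g f hN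
  have hn0 : (0 : ℤ) < (nL κ Φ t p D g f : ℤ) := by exact_mod_cast hn1
  have hv := abs_le.1 hN.v_le
  have hκ' : |hL κ Φ t p D g f| ≤ 10 * (nL κ Φ t p D g f : ℤ) := by rw [← Int.natCast_natAbs]; exact_mod_cast hκ
  have hh := abs_le.1 hκ'
  have hUe : (shearUnit (nL κ Φ t p D g f) (hL κ Φ t p D g f) : ℤ) = (nL κ Φ t p D g f : ℤ) + |hL κ Φ t p D g f| := by
    unfold Skelφ.shearUnit; push_cast [Int.natCast_natAbs]; rfl
  have hσabs : |σ| = 1 := by rcases hσ with h | h <;> simp [h]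
  have hσTabs : |σT| = 1 := by rcases hσT with h | h <;> simp [h]
  -- the cross shift's transverse rounding `⌊σT h v / n⌋ ∈ [−|h| − 1, |h|]`
  obtain ⟨f1, f2⟩ := PlanarSkeletonNeg.NegB.RootArith.floor_sandwich (x := σT * hL κ Φ t p D g f * vL κ Φ t p D g f) hn0
  have hxv : |σT * hL κ Φ t p D g f * vL κ Φ t p D g f| ≤ |hL κ Φ t p D g f| * (nL κ Φ t p D g f : ℤ) := by
    rw [abs_mul, abs_mul, hσTabs, one_mul]; exact mul_le_mul_of_nonneg_left hN.v_le (abs_nonneg _)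
  obtain ⟨x1, x2⟩ := abs_le.1 hxv
  set q := σT * hL κ Φ t p D g f * vL κ Φ t p D g f / (nL κ Φ t p D g f : ℤ) with hq
  have hq1 : q ≤ |hL κ Φ t p D g f| := by
    by_contra hc; push Not at hc
    have : (nL κ Φ t p D g f : ℤ) * (|hL κ Φ t p D g f| + 1) ≤ (nL κ Φ t p D g f : ℤ) * q := mul_le_mul_of_nonneg_left (by linarith) hn0.le
    nlinarith
  have hq2 : -(|hL κ Φ t p D g f| + 1) ≤ q := by
    by_contra hc; push Not at hc
    have : (nL κ Φ t p D g f : ℤ) * q ≤ (nL κ Φ t p D g f : ℤ) * (-(|hL κ Φ t p D g f| + 1) - 1) := mul_le_mul_of_nonneg_left (by linarith) hn0.le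
    nlinarith
  have hk0 : (0 : ℤ) ≤ (Nr : ℤ) + 1 := by positivity
  have e0 : (yL + crossOffX (nL κ Φ t p D g f) (hL κ Φ t p D g f) (vL κ Φ t p D g f) σ σT Nr) 0 =
      yL 0 + (σ * (((Nr : ℤ) + 1) * (nL κ Φ t p D g f : ℤ)) + σT * vL κ Φ t p D g f) := by
    simp only [Pi.add_apply, Skelφ.crossOffX, Skelφ.pt_zero]
  have e1 : (yL + crossOffX (nL κ Φ t p D g f) (hL κ Φ t p D g f) (vL κ Φ t p D g f) σ σT Nr) 1 =
      yL 1 + (σ * (((Nr : ℤ) + 1) * hL κ Φ t p D g f) + q) := by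
    simp only [Pi.add_apply, Skelφ.crossOffX, Skelφ.pt_one, hq]
  have b0 : |σ * (((Nr : ℤ) + 1) * (nL κ Φ t p D g f : ℤ)) + σT * vL κ Φ t p D g f| ≤ ((Nr : ℤ) + 1) * (nL κ Φ t p D g f : ℤ) + nL κ Φ t p D g f := by
    calc |σ * (((Nr : ℤ) + 1) * (nL κ Φ t p D g f : ℤ)) + σT * vL κ Φ t p D g f|
        ≤ |σ * (((Nr : ℤ) + 1) * (nL κ Φ t p D g f : ℤ))| + |σT * vL κ Φ t p D g f| := abs_add_le _ _
      _ ≤ ((Nr : ℤ) + 1) * (nL κ Φ t p D g f : ℤ) + nL κ Φ t p D g f := by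
          have p1 : |σ * (((Nr : ℤ) + 1) * (nL κ Φ t p D g f : ℤ))| = ((Nr : ℤ) + 1) * (nL κ Φ t p D g f : ℤ) := by
            rw [abs_mul, hσabs, one_mul, abs_of_nonneg (by positivity)]
          have p2 : |σT * vL κ Φ t p D g f| ≤ (nL κ Φ t p D g f : ℤ) := by rw [abs_mul, hσTabs, one_mul]; exact hN.v_le
          linarith
  have b1 : |σ * (((Nr : ℤ) + 1) * hL κ Φ t p D g f) + q| ≤ ((Nr : ℤ) + 1) * |hL κ Φ t p D g f| + (10 * (nL κ Φ t p D g f : ℤ) + 1) := by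
    calc |σ * (((Nr : ℤ) + 1) * hL κ Φ t p D g f) + q| ≤ |σ * (((Nr : ℤ) + 1) * hL κ Φ t p D g f)| + |q| := abs_add_le _ _
      _ ≤ ((Nr : ℤ) + 1) * |hL κ Φ t p D g f| + (10 * (nL κ Φ t p D g f : ℤ) + 1) := by
          have p1 : |σ * (((Nr : ℤ) + 1) * hL κ Φ t p D g f)| = ((Nr : ℤ) + 1) * |hL κ Φ t p D g f| := by
            rw [abs_mul, hσabs, one_mul, abs_mul, abs_of_nonneg hk0]
          have p2 : |q| ≤ 10 * (nL κ Φ t p D g f : ℤ) + 1 := abs_le.2 ⟨by linarith, by linarith⟩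
          linarith
  have key : (((yL + crossOffX (nL κ Φ t p D g f) (hL κ Φ t p D g f) (vL κ Φ t p D g f) σ σT Nr) 0).natAbs : ℤ) +
      (((yL + crossOffX (nL κ Φ t p D g f) (hL κ Φ t p D g f) (vL κ Φ t p D g f) σ σT Nr) 1).natAbs : ℤ) ≤
      ((yL 0).natAbs : ℤ) + ((yL 1).natAbs : ℤ) + ((Nr : ℤ) + 1) * (shearUnit (nL κ Φ t p D g f) (hL κ Φ t p D g f) : ℤ) + 11 * (nL κ Φ t p D g f : ℤ) + 1 := by
    simp only [Int.natCast_natAbs]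
    rw [e0, e1, hUe]
    have t0 := abs_add_le (yL 0) (σ * (((Nr : ℤ) + 1) * (nL κ Φ t p D g f : ℤ)) + σT * vL κ Φ t p D g f)
    have t1 := abs_add_le (yL 1) (σ * (((Nr : ℤ) + 1) * hL κ Φ t p D g f) + q)
    nlinarith [abs_nonneg (hL κ Φ t p D g f)]
  exact_mod_cast key

/-- **THE G-π REACH BUDGET of an x-face** (N2: a NAMED number; N1 discharged it against the slot `exA` in this file — in N2 the one floor
`πBudX c mk g f ≤ r` is served by the residual-slot file of record on `exQ`, stmt-g21 (S3)): origin budget `YbF` + along run `600·Kq·U` + cross shift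
`11·n_L + 1` + tangential drift `1000·Kq·n_L + 1000·Kq·ℓ_L + 10000·Kq·n_L + 12`, plus one. [folklore] -/
def πBudX (κ : Consts) {V : Type} [DecidableEq V] [Countable V] {G : SimpleGraph V} [G.LocallyFinite] (Φ : PlanarSkeletonFrmQuasi G) (t : V) (p : unitInterval) (D : Skelφ.StepI.DataNS V) (c : ℕ) (mk : ℕ) (g : ℕ) (f : ℕ) : ℕ :=
  YbF κ Φ t p D c mk g f + 600 * Neg.Kq κ * shearUnit (nL κ Φ t p D g f) (hL κ Φ t p D g f) + 11 * nL κ Φ t p D g f + 1 +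
    (1000 * Neg.Kq κ * nL κ Φ t p D g f + 1000 * Neg.Kq κ * ℓL κ Φ t p D g f + 10000 * Neg.Kq κ * nL κ Φ t p D g f + 12) + 1

end Sizes

/-! ## §3 The two G-π fields at the (ζ′) tuple -/

section Fields

-- GEN-Q (R-2, captain 2026-08-27): `PlanarSkeletonFrmFrom.NegB.KS.hπ2X_XA` is not in the used cone of the node top — not ported.

-- GEN-Q (R-2, captain 2026-08-27): `PlanarSkeletonFrmFrom.NegB.KS.hπ3X_XA` is not in the used cone of the node top — not ported.

end Fields

end KS

end NegB

end PlanarSkeletonFrmQuasi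

end Summit.CriticalPhenomena.PercolationContinuityZ3.Theorems.Transplant

end
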